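import Literature.Combinatorics.Optimization.CorrelationPolytopeMinorMonotone
import Literature.Barriers.PneNP.CorrelationPolytopeXCLowerBoundGraph
import Literature.Barriers.PneNP.TSPExtensionComplexityFaces
import Literature.Barriers.PneNP.ExtendedFormulationLinearImage
import HarnessLib

/-!
# From a clique face of `COR(G_{t,t})` to the grid bound `xc(COR(G_{t,t})) ≥ 2^{Ω(t)}` and to the
# named fact `AboulkerEtAl2019_corGridMinor` (the last paragraph of the proof of AFHMS 2019, Thm. 6)

[topic Combinatorics/Optimization]

P. Aboulker, S. Fiorini, T. Huynh, M. Macchia, J. Seif, *Extension complexity of the correlation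
polytope*, Oper. Res. Lett. 47 (2019) 47–51 = arXiv:1806.00541 [AboulkerEtAl2019] (held text
`paper:arxiv-1806.00541`), proof of Theorem 6, last paragraph (p0006 L19–27): once "the face of
`COR(H)` described above projects to `COR(K_{h,h})`" and "`K_h` is a minor of `K_{h,h}`", the bound
follows from "If `A` is an affine subspace, then `xc(P ∩ A) ≤ xc(P)`, and if `π` is an affine map,
then `xc(π(P)) ≤ xc(P)`" (p0005 L3) and "In [KW15], it is shown that `xc(COR(K_h)) ≥ (1.5)^h`. …
Since `h = Ω(tw(G))`, this completes the proof."

This file is that paragraph in the tree's currency, Literature-side (the `ValiantsHypothesis` route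
has its own Summits-side twin `corGridBound_of_gridCorCliqueFace`, which a Literature file cannot
import): the HYPOTHESIS is the literal statement of the construction (the support item
`GridCorCliqueFace`, "FORM A": for `t ≥ t₀` a face of `corPolytopeGraph (gridGraph t)` cut out by
finitely many valid inequalities maps linearly ONTO `corPolytopeGraph ⊤` on `Fin h`, `h ≥ c·t`), the
CONCLUSIONS are

* `AboulkerEtAl2019_corGridBound_of_cliqueFace` — the grid-only bound
  `∃ c > 0, ∃ h₀, ∀ h ≥ h₀, ∀ R, HasEFOfSize (corPolytopeGraph (gridGraph h)) R → 2^{c h} ≤ R`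
  (faces by equations are free: `HasEFOfSize.inter_eqs`; linear images are free:
  `HasEFOfSize.image_linearMap`; `xc(COR(K_h)) ≥ 2^{h/2}` for `h ≥ 4`:
  `corPolytopeGraph_top_two_pow_half_le`, the tree's Kaibel–Weltge bound; constants: `c/2` and the
  threshold `max t₀ ⌈4/c⌉`);
* `AboulkerEtAl2019_corGridMinor_of_cliqueFace` — hence the named fact
  `AboulkerEtAl2019_corGridMinor` of `CorrelationPolytopeGridMinor.lean` (grid minors force
  `xc(COR(G)) ≥ 2^{ch}`), by `AboulkerEtAl2019_corGridMinor_iff_grid` (Observation 5, proved in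
  `CorrelationPolytopeMinorMonotone.lean`).

So the fact's discharge `AboulkerEtAl2019_corGridMinor_holds` is ONE `exact` away from a proof of
FORM A (`GridCorTiling.formA_of_blocks` + the block modules).  No definition, no named fact.

## References

* [AboulkerEtAl2019] P. Aboulker, S. Fiorini, T. Huynh, M. Macchia, J. Seif, *Extension complexity
  of the correlation polytope*, Oper. Res. Lett. 47 (2019) 47–51 = arXiv:1806.00541; §2 folklore
  facts (p0005 L3), proof of Thm. 6, last paragraph (p0006 L19–27), remark after Thm. 3 (p0004 L1).
* [KaibelWeltge2014] V. Kaibel, S. Weltge, *A short proof that the extension complexity of the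
  correlation polytope grows exponentially*, DCG 53 (2015) — the tree's `corPolytope_xc_ge` /
  `corPolytopeGraph_top_two_pow_half_le`.
* [FioriniEtAl2015] S. Fiorini et al., *Exponential lower bounds for polytopes in combinatorial
  optimization*, J. ACM 62 (2015), Lemma 9 — the tree's `HasEFOfSize.inter_eqs` / `image_linearMap`.
-/

noncomputable section

namespace Literature.Combinatorics.Optimization

open Literature.Barriers.PneNP (HasEFOfSize corPolytopeGraph_top_two_pow_half_le)
open Literature.Computability.MetaComplexity (gridGraph)

/-- **The grid bound from a clique face** ("it suffices to show the theorem for `H` … the face …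
projects to `COR(K_{h,h})` … `xc(COR(K_h)) ≥ (1.5)^h` … this completes the proof"): if for all
`t ≥ t₀` some face of `COR(G_{t,t})` cut out by finitely many inequalities valid on `COR(G_{t,t})`
is mapped by a linear map ONTO `COR(K_h)` with `h ≥ c·t` (`c > 0`), then
`xc(COR(G_{t,t})) ≥ 2^{(c/2)·t}` for all `t ≥ max t₀ ⌈4/c⌉`: every size `R` of an extended
formulation of `corPolytopeGraph (gridGraph t)` satisfies `2^{(c/2) t} ≤ R`.
[cite: AboulkerEtAl2019, proof of Thm. 6, last paragraph (arXiv:1806.00541 p0006 L19–27) with the folklore facts §2 (p0005 L3)] [cite: KaibelWeltge2014, Thm. 1] -/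
theorem AboulkerEtAl2019_corGridBound_of_cliqueFace
    (hA : ∃ c : ℝ, 0 < c ∧ ∃ t₀ : ℕ, ∀ t : ℕ, t₀ ≤ t → ∃ h : ℕ, c * t ≤ h ∧
      ∃ (k : ℕ) (cv : Fin k → (Fin (t * t) × Fin (t * t) → ℝ)) (δ : Fin k → ℝ)
        (π : (Fin (t * t) × Fin (t * t) → ℝ) →ₗ[ℝ] (Fin h × Fin h → ℝ)),
        (∀ i, ∀ x ∈ corPolytopeGraph (gridGraph t), cv i ⬝ᵥ x ≤ δ i) ∧
          π '' (corPolytopeGraph (gridGraph t) ∩ {x | ∀ i, cv i ⬝ᵥ x = δ i}) =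
            corPolytopeGraph (⊤ : SimpleGraph (Fin h))) :
    ∃ c : ℝ, 0 < c ∧ ∃ h₀ : ℕ, ∀ h : ℕ, h₀ ≤ h →
      ∀ R : ℕ, HasEFOfSize (corPolytopeGraph (gridGraph h)) R → (2 : ℝ) ^ (c * h) ≤ R := by
  obtain ⟨c, hc, t₀, hA⟩ := hA
  refine ⟨c / 2, by positivity, max t₀ ⌈4 / c⌉₊, fun t ht R hR => ?_⟩
  have ht₀ : t₀ ≤ t := le_trans (le_max_left _ _) ht
  have ht4 : (4 : ℝ) ≤ c * t := by
    have h1 : (⌈4 / c⌉₊ : ℝ) ≤ t := by exact_mod_cast le_trans (le_max_right _ _) ht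
    have h2 : 4 / c ≤ ⌈4 / c⌉₊ := Nat.le_ceil _
    calc (4 : ℝ) = c * (4 / c) := by field_simp
      _ ≤ c * t := by nlinarith
  obtain ⟨h, hch, k, cv, δ, π, _, himg⟩ := hA t ht₀
  have hh4 : 4 ≤ h := by exact_mod_cast (le_trans ht4 hch : (4 : ℝ) ≤ h)
  -- the face is free, the projection is free, and `xc(COR(K_h)) ≥ 2^{h/2}`
  have hface : HasEFOfSize (corPolytopeGraph (gridGraph t) ∩ {x | ∀ i, cv i ⬝ᵥ x = δ i}) R :=
    hR.inter_eqs cv δ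
  have himage : HasEFOfSize (corPolytopeGraph (⊤ : SimpleGraph (Fin h))) R := by
    rw [← himg]
    exact hface.image_linearMap π
  have hbound := corPolytopeGraph_top_two_pow_half_le hh4 himage
  calc (2 : ℝ) ^ (c / 2 * t) ≤ (2 : ℝ) ^ ((h : ℝ) / 2) :=
        Real.rpow_le_rpow_of_exponent_le (by norm_num) (by linarith)
    _ ≤ R := hbound

/-- **The named fact from a clique face**: the grid bound (previous theorem) and Observation 5
(`AboulkerEtAl2019_corGridMinor_iff_grid`) give `AboulkerEtAl2019_corGridMinor` — grid MINORS force
`xc(COR(G)) ≥ 2^{ch}`. [cite: AboulkerEtAl2019, remark after Thm. 3 (p0004 L1), Obs. 5 (p0005 L12–13) and proof of Thm. 6 (p0006 L19–27)] -/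
theorem AboulkerEtAl2019_corGridMinor_of_cliqueFace
    (hA : ∃ c : ℝ, 0 < c ∧ ∃ t₀ : ℕ, ∀ t : ℕ, t₀ ≤ t → ∃ h : ℕ, c * t ≤ h ∧
      ∃ (k : ℕ) (cv : Fin k → (Fin (t * t) × Fin (t * t) → ℝ)) (δ : Fin k → ℝ)
        (π : (Fin (t * t) × Fin (t * t) → ℝ) →ₗ[ℝ] (Fin h × Fin h → ℝ)),
        (∀ i, ∀ x ∈ corPolytopeGraph (gridGraph t), cv i ⬝ᵥ x ≤ δ i) ∧
          π '' (corPolytopeGraph (gridGraph t) ∩ {x | ∀ i, cv i ⬝ᵥ x = δ i}) =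
            corPolytopeGraph (⊤ : SimpleGraph (Fin h))) :
    AboulkerEtAl2019_corGridMinor :=
  AboulkerEtAl2019_corGridMinor_iff_grid.2 (AboulkerEtAl2019_corGridBound_of_cliqueFace hA)

end Literature.Combinatorics.Optimization

end
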